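import Literature.Analysis.FluidPDE.FiniteFourierModeEulerPlanarHoriz

/-!
# Kishimoto–Yoneda §3 (planar case): the vertical component is transported

Support file for `FiniteFourierModeEuler` (N. Kishimoto, T. Yoneda, J. Math. Fluid Mech. 24
(2022) 74 = arXiv:2110.08039), §3 (cond:Euler^h): "the vertical component of the equation
(cond:Euler) reads as `∂_t u^⊥_n(t) + i Σ_{n'+ñ=n} (u^∥_{n'}·ñ) u^⊥_ñ(t) = 0`, or
`∂_t u^⊥ + (u^∥·∇)u^⊥ = 0`." In the coordinates of `FiniteFourierModeEulerPlanarCoord`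
(`u_n = α_n (e × n) + w_n e`, `u^∥_{n'}·ñ = α_{n'} τ(n', ñ)`) this is the linear system
`∂_t w_n = -(A w)_n`, `(A x)_n = i Σ_{(n₁,n₂) ∈ S², n₁+n₂=n} τ(n₁,n₂) α_{n₁} x_{n₂}`
(`planarOp`), valid at EVERY frequency `n` (at unoccupied `n` it is the constraint `(A w)_n = 0`).
We also record the same operator with an abstract coefficient function `α` and support `T`,
acting on arbitrary coefficient functions `φ` (`convOp`, used in the proof of Prop. 3.1 (ii)).

## References

* [KishimotoYoneda2022] N. Kishimoto, T. Yoneda, J. Math. Fluid Mech. 24 (2022) 74 =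
  arXiv:2110.08039, §3 (cond:Euler^h).
-/

noncomputable section

open Matrix Finset Complex

namespace Literature.Analysis.FluidPDE

namespace KY

open scoped Classical

/-! ### The vertical transport operator (abstract form) -/

/-- The vertical transport operator on Fourier coefficients:
`(A φ)_n = i Σ_{n' ∈ T} τ(n', n - n') α_{n'} φ_{n - n'}`. [cite: KishimotoYoneda2022, §3 (cond:Euler^h)] -/
def convOp (T : Finset (Fin 3 → ℝ)) (e : Fin 3 → ℝ) (α φ : (Fin 3 → ℝ) → ℂ) (n : Fin 3 → ℝ) : ℂ :=
  Complex.I * ∑ m ∈ T, ((pc e m (n - m) : ℝ) : ℂ) * α m * φ (n - m)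

section ConvOp

variable (T : Finset (Fin 3 → ℝ)) (e : Fin 3 → ℝ) (α : (Fin 3 → ℝ) → ℂ)

/-- Linearity of `A`. [folklore] -/
theorem convOp_add (φ ψ : (Fin 3 → ℝ) → ℂ) (n : Fin 3 → ℝ) :
    convOp T e α (φ + ψ) n = convOp T e α φ n + convOp T e α ψ n := by
  unfold convOp; rw [← mul_add, ← Finset.sum_add_distrib]
  congr 1; refine Finset.sum_congr rfl fun m _ => ?_; simp only [Pi.add_apply]; ring

/-- Linearity rule `convOp_smul`. [folklore] -/
theorem convOp_smul (c : ℂ) (φ : (Fin 3 → ℝ) → ℂ) (n : Fin 3 → ℝ) :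
    convOp T e α (c • φ) n = c * convOp T e α φ n := by
  unfold convOp; rw [Finset.mul_sum, Finset.mul_sum, Finset.mul_sum]
  refine Finset.sum_congr rfl fun m _ => ?_; simp only [Pi.smul_apply, smul_eq_mul]; ring

/-- Linearity rule `convOp_sub`. [folklore] -/
theorem convOp_sub (φ ψ : (Fin 3 → ℝ) → ℂ) (n : Fin 3 → ℝ) :
    convOp T e α (φ - ψ) n = convOp T e α φ n - convOp T e α ψ n := by
  rw [sub_eq_add_neg, convOp_add, show -ψ = (-1 : ℂ) • ψ by simp, convOp_smul]; ring

end ConvOp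

/-- The transport operator of the vertical component: `(A x)_n = i Σ_{n₁+n₂=n} τ(n₁,n₂) α_{n₁} x_{n₂}`
over ordered pairs of `S`. [cite: KishimotoYoneda2022, §3 (cond:Euler^h)] -/
def planarOp (S : Finset (Fin 3 → ℝ)) (e : Fin 3 → ℝ) (α x : (Fin 3 → ℝ) → ℂ) (n : Fin 3 → ℝ) : ℂ :=
  Complex.I * ∑ q ∈ (S ×ˢ S).filter (fun q : (Fin 3 → ℝ) × (Fin 3 → ℝ) => q.1 + q.2 = n),
    ((pc e q.1 q.2 : ℝ) : ℂ) * α q.1 * x q.2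

/-- **Swap symmetrisation** over the ordered pairs with a fixed sum: a summand changing sign under
`(n₁, n₂) ↦ (n₂, n₁)` sums to zero. [folklore] -/
theorem sum_pairs_antisymm (S : Finset (Fin 3 → ℝ)) (n : Fin 3 → ℝ)
    (f : (Fin 3 → ℝ) × (Fin 3 → ℝ) → ℂ) (hf : ∀ a b, f (b, a) = -f (a, b)) :
    ∑ q ∈ (S ×ˢ S).filter (fun q : (Fin 3 → ℝ) × (Fin 3 → ℝ) => q.1 + q.2 = n), f q = 0 := by
  set F := (S ×ˢ S).filter (fun q : (Fin 3 → ℝ) × (Fin 3 → ℝ) => q.1 + q.2 = n) with hF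
  have hswap : ∑ q ∈ F, f q = ∑ q ∈ F, f (q.2, q.1) := by
    apply Finset.sum_equiv (Equiv.prodComm _ _)
    · rintro ⟨a, b⟩
      simp only [hF, Finset.mem_filter, Finset.mem_product, Equiv.prodComm_apply, Prod.swap_prod_mk]
      constructor
      · rintro ⟨⟨ha, hb⟩, h⟩; exact ⟨⟨hb, ha⟩, by rw [add_comm]; exact h⟩
      · rintro ⟨⟨hb, ha⟩, h⟩; exact ⟨⟨ha, hb⟩, by rw [add_comm]; exact h⟩
    · rintro ⟨a, b⟩ -; rfl
  have : ∑ q ∈ F, f (q.2, q.1) = -∑ q ∈ F, f q := by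
    rw [← Finset.sum_neg_distrib]
    refine Finset.sum_congr rfl fun q _ => ?_
    rcases q with ⟨a, b⟩
    exact hf a b
  rw [this] at hswap
  have h2 : (2 : ℂ) * ∑ q ∈ F, f q = 0 := by rw [two_mul]; nth_rewrite 2 [hswap]; ring
  exact (mul_eq_zero.1 h2).resolve_left two_ne_zero

namespace PlanarCfg

variable {I : Set ℝ} {S : Finset (Fin 3 → ℝ)} {u : (Fin 3 → ℝ) → ℝ → (Fin 3 → ℂ)}
  {e : Fin 3 → ℝ} {S_h : Finset (Fin 3 → ℝ)} (P : PlanarCfg I S u e S_h)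
include P

omit P in
/-- The vertical coordinate, as an explicit combination of coordinates. [folklore] -/
theorem vert_apply (z : Fin 3 → ℂ) : vert e z = (∑ j, (e j : ℂ) * z j) / dot (cplx e) (cplx e) := by
  unfold vert dot; simp [cplx_apply]

/-- The vertical coordinate of a mode is differentiable on `I`. [folklore] -/
theorem differentiableOn_vert (n : Fin 3 → ℝ) : DifferentiableOn ℝ (fun s => vert e (u n s)) I := by
  have h : (fun s => vert e (u n s)) = fun s => (∑ j, (e j : ℂ) * u n s j) / dot (cplx e) (cplx e) := by
    funext s; rw [vert_apply]
  rw [h]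
  apply DifferentiableOn.div_const
  exact DifferentiableOn.fun_sum fun j _ => (P.sol.differentiableOn n j).const_mul _

/-- **The derivative of the vertical coordinate is the vertical coordinate of the derivative.**
[folklore] -/
theorem deriv_vert (n : Fin 3 → ℝ) {t : ℝ} (ht : t ∈ I) :
    deriv (fun s => vert e (u n s)) t = vert e (fun j => deriv (fun s => u n s j) t) := by
  have h : (fun s => vert e (u n s)) = fun s => (∑ j, (e j : ℂ) * u n s j) / dot (cplx e) (cplx e) := by
    funext s; rw [vert_apply]
  rw [h, vert_apply]
  have hd : ∀ j, DifferentiableAt ℝ (fun s => u n s j) t := fun j => P.differentiableAt_coord n j ht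
  rw [deriv_div_const, deriv_fun_sum fun j _ => (hd j).const_mul _]
  congr 2
  funext j
  rw [deriv_const_mul _ (hd j)]

/-- The vertical coordinate of the nonlinearity is `A w` (at every frequency).
[cite: KishimotoYoneda2022, §3 (cond:Euler^h)] -/
theorem vert_nonlin (n : Fin 3 → ℝ) {t : ℝ} (ht : t ∈ I) :
    vert e (nonlin S (fun m => u m t) n)
      = planarOp S e (fun m => hcoef e m (u m t)) (fun m => vert e (u m t)) n := by
  unfold planarOp
  by_cases hn : e ⬝ᵥ n = 0
  · rw [nonlin_eq_sum_bracket, vert_smul, vert_proj hn, vert_sum]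
    have hb : ∀ q ∈ (S ×ˢ S).filter (fun q : (Fin 3 → ℝ) × (Fin 3 → ℝ) => q.1 + q.2 = n),
        vert e (bracket q.1 q.2 (u q.1 t) (u q.2 t))
          = ((pc e q.1 q.2 : ℝ) : ℂ) * (hcoef e q.1 (u q.1 t) * vert e (u q.2 t)
              - hcoef e q.2 (u q.2 t) * vert e (u q.1 t)) := by
      rintro ⟨a, b⟩ hq
      simp only [Finset.mem_filter, Finset.mem_product] at hq
      obtain ⟨⟨ha, hb⟩, -⟩ := hq
      exact vert_bracket_planar P.he (P.plane a ha) (P.plane b hb) (P.decomp_mem ha ht) (P.decomp_mem hb ht)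
    rw [Finset.sum_congr rfl hb]
    -- symmetrise: the `α₂ w₁` terms equal minus the `α₁ w₂` terms after swapping
    have hsplit : ∀ q : (Fin 3 → ℝ) × (Fin 3 → ℝ),
        ((pc e q.1 q.2 : ℝ) : ℂ) * (hcoef e q.1 (u q.1 t) * vert e (u q.2 t)
            - hcoef e q.2 (u q.2 t) * vert e (u q.1 t))
          = ((pc e q.1 q.2 : ℝ) : ℂ) * hcoef e q.1 (u q.1 t) * vert e (u q.2 t)
            + ((pc e q.1 q.2 : ℝ) : ℂ) * hcoef e q.1 (u q.1 t) * vert e (u q.2 t)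
            - (((pc e q.1 q.2 : ℝ) : ℂ) * hcoef e q.1 (u q.1 t) * vert e (u q.2 t)
              + ((pc e q.1 q.2 : ℝ) : ℂ) * hcoef e q.2 (u q.2 t) * vert e (u q.1 t)) := by
      intro q; ring
    simp only [hsplit, Finset.sum_sub_distrib]
    rw [sum_pairs_antisymm S n (fun q => ((pc e q.1 q.2 : ℝ) : ℂ) * hcoef e q.1 (u q.1 t) * vert e (u q.2 t)
        + ((pc e q.1 q.2 : ℝ) : ℂ) * hcoef e q.2 (u q.2 t) * vert e (u q.1 t))
        (fun a b => by simp only [pc_anticomm e a b]; push_cast; ring)]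
    rw [sub_zero]
    have : ∀ q : (Fin 3 → ℝ) × (Fin 3 → ℝ),
        ((pc e q.1 q.2 : ℝ) : ℂ) * hcoef e q.1 (u q.1 t) * vert e (u q.2 t)
          + ((pc e q.1 q.2 : ℝ) : ℂ) * hcoef e q.1 (u q.1 t) * vert e (u q.2 t)
          = 2 * (((pc e q.1 q.2 : ℝ) : ℂ) * hcoef e q.1 (u q.1 t) * vert e (u q.2 t)) := fun q => by ring
    simp only [this, ← Finset.mul_sum]
    ring
  · rw [nonlin_eq_sum_bracket, P.filter_pairs_eq_empty hn subset_rfl, Finset.sum_empty, Finset.sum_empty,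
      proj_zero, smul_zero, vert_zero, mul_zero]

/-- **(cond:Euler^h) in coordinates: `∂_t w_n = -(A w)_n` at every frequency.** At unoccupied
frequencies this is the constraint `(A w)_n = 0`. [cite: KishimotoYoneda2022, §3 (cond:Euler^h)] -/
theorem deriv_vert_eq (n : Fin 3 → ℝ) {t : ℝ} (ht : t ∈ I) :
    deriv (fun s => vert e (u n s)) t
      = -planarOp S e (fun m => hcoef e m (u m t)) (fun m => vert e (u m t)) n := by
  by_cases hn0 : n = 0
  · -- the zero frequency: both sides vanish
    subst hn0
    have hz : (fun s => vert e (u 0 s)) = fun _ => 0 := by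
      funext s; rw [P.sol.eq_zero_of_notMem 0 P.sol.zero_notMem s, vert_zero]
    rw [hz, deriv_const]
    unfold planarOp
    rw [Finset.sum_eq_zero, mul_zero, neg_zero]
    rintro ⟨a, b⟩ hq
    simp only [Finset.mem_filter, Finset.mem_product] at hq
    have : b = -a := eq_neg_of_add_eq_zero_right hq.2
    rw [this, pc_neg_right, pc_self]; simp
  · rw [P.deriv_vert n ht, P.deriv_vec_eq hn0 ht, ← P.vert_nonlin n ht]
    rw [show -nonlin S (fun m => u m t) n = (-1 : ℂ) • nonlin S (fun m => u m t) n by simp, vert_smul]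
    ring

/-- The constraint at unoccupied frequencies: `(A w)_n = 0` for `n ∉ S`.
[cite: KishimotoYoneda2022, §3 (cond:Euler^h) with §1 (1.3)] -/
theorem planarOp_eq_zero_of_notMem {n : Fin 3 → ℝ} (hn : n ∉ S) {t : ℝ} (ht : t ∈ I) :
    planarOp S e (fun m => hcoef e m (u m t)) (fun m => vert e (u m t)) n = 0 := by
  have h := P.deriv_vert_eq n ht
  have hz : (fun s => vert e (u n s)) = fun _ => 0 := by
    funext s; rw [P.sol.eq_zero_of_notMem n hn s, vert_zero]
  rw [hz, deriv_const] at h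
  exact (neg_eq_zero.1 h.symm)

end PlanarCfg

end KY

end Literature.Analysis.FluidPDE
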